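import Summits.QuantumFields.YangMills.Theorems.BalabanUVNodesC44IterMhHierFrameTower
import Summits.QuantumFields.YangMills.Theorems.BalabanUVNodesC44IterMhFramedAtRecord
import HarnessLib

/-!
# [B7] (81), (89) AT THE RECORD: THE HIERARCHICAL FRAME OF `e^{iY}U₀` IS WITHIN `40000·L^k‖Y‖` OF `1` AND `e^{iY}U₀` LIES IN THE WINDOW — (T1)∕(T2) OF THE (ρ-frame-min)
# EDITION AS THEOREMS for node00-def-Y's `hierFrameDatumOfRecord F N k U₀`, from the loop profile of the real tower (F5ᵖʳ's hypotheses VERBATIM), k-UNIFORMLY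

Cell `pub-ymgap` ∕ `ym-nodeO-ideate`, porter lineage `ymgap-nodeO-port-PTB-1` (gen 10); director-ym g24 №628 (2)–(3) («PT-B's lineage owns (T1)∕(T2)»).  `--kind proof --supports
stmt-QuantumFields-27238 --as helper`; count-neutral; NEW basename.  [B7] = [Balaban1985Averaging]; [B11] = [Balaban1985Variational]; [I] = [Balaban1987RG1].

THE ROAD (three files): ✓`…HierFrameStep` (one level, no growth factor) → ✓`…HierFrameTower` (any one-step-absorbing budget dominates all levels) → THIS FILE (the record's numbers):
* §1 the inputs at every level `j ≤ k` from F4′'s outputs: ★ `norm_iterMh_expOver_mul_star_sub_one_le_level` (`‖Ū^j_h(e^{iY}U₀)(b)·Ū^j(U₀)(b)⋆ − 1‖ ≤ 8000·L^j‖Y‖`, ✓Polydisc (b) read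
  at level `j`, the level-`k` smallness rows being monotone in the level), `det_iterMh_expOver_eq_one` (✓`tower_induction`: `Ū^j_h = G•Ṽ`, `det G = det Ṽ = 1`), ★ `norm_ctrHolM_iterMh_expOver_sub_one_le`
  (the contour dressing `τ_j ≤ 32000·L^{j+1}‖Y‖·(1 + 32000·L^{j+1}‖Y‖)`: `≤ 2(L−1)` steps of `2·8000·L^j‖Y‖` each).
* §2 the budget `B_j := 40000·L^j‖Y‖` absorbs one step for `L ≥ 12` on the traceless scaled polydisc `L^k‖Y‖ < ρ₀ = (2.5·10¹⁰·L·N)⁻¹` (`budget_step`: the level sum is geometric FROM THE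
  TOP; the quadratic terms are `≤ L^{j+1}‖Y‖`), whence ★★★ `norm_framePair_expOver_sub_one_le`: `‖Φ_j(e^{iY}U₀)(x) − 1‖, ‖Ψ_j(e^{iY}U₀)(x) − 1‖ ≤ 40000·L^j‖Y‖` for ALL `j ≤ k` — the
  constant is INDEPENDENT OF `k` (and of `L`, `N`).
* §3 ★★★ `expOver_mem_hierFrameDom` ((T1): loops by ✓`polydiscPackage_of_loopProfile`, arguments of the logarithms by ✓`norm_frameArg_framePair_sub_one_le_of_budget`) and, in the EXACT
  binder shapes PT-B's framed doors display, ★★★ `hierFrameDatumOfRecord_hdom` ∕ ★★★ `hierFrameDatumOfRecord_hnear` with `c𝔥 = 40000` (on the guard the datum is the genuine branch).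

HONEST FRAMING.  Crude explicit constants in the complex sup-norm currency of PT-B's (44) files; `c𝔥 = 40000 > 10³`, so F5ᵖʳ's displayed `hc : c𝔥 ≤ 1000` is NOT met by this theorem —
the F5ᵖʳ chain is re-pressed at `c𝔥 = 40000` in the sequel (constants `C₂`, radius change; recipe g9).  This is [B7] (81)∕(89)-class bookkeeping, NOT (101)–(112)'s Hölder bounds, NOT
Prop. 5, NOT [B11] Prop. 4; the loop profile of the background tower is DISPLAYED (supplied at the record by ✓`loopProfile_of_regular`); K0ᴬ ⟨stmt-QuantumFields-27238⟩ NOT closed;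
NODE O 0∕1; COUNT 8∕28 · K 1∕4 UNMOVED; finite `𝕋⁴_{L^K}` at fixed ε — NOT continuum ∕ OS ∕ Clay; **the Yang–Mills mass gap (Clay) is NOT proved by any of this.**  No `sorry`,
`instance`, `notation`, `set_option`; standard axioms.
-/

noncomputable section

open scoped Matrix Matrix.Norms.L2Operator Topology

namespace Summit.QuantumFields.YangMills.Theorems.C44IterMh

open Literature.MathematicalPhysics.QuantumFieldTheory.Balaban1983to89
open Literature.MathematicalPhysics.QuantumFieldTheory.Balaban1983to89.Node00
open T4Continuum BlockAveraging
open B15AveragingHolomorphic (iterMh loopMh)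
open ExpMeanLog (expMeanLogSU)

section Record

variable (F : T4Family) (N : ℕ) [NeZero N] {K : ℕ} (k : ℕ) (U₀ : GaugeField (F.P K) 0 (SU N))

/-! ## §1  The inputs at every level `j ≤ k` -/

/-- ★ **✓Polydisc (b) AT EVERY LEVEL `j ≤ k`**: `‖Ū^j_h(e^{iY}U₀)(b)·Ū^j(U₀)(b)⋆ − 1‖ ≤ 8000·L^j‖Y‖` on the traceless scaled polydisc `L^k‖Y‖ < ρ₀` from the loop profile of the real
tower (the level-`k` smallness rows of F4′ are monotone in the level: `L^j ≤ L^k`, `Σ_{i<j} ε_i ≤ Σ_{i<k} ε_i`). [cite: Balaban1985Variational, (51)–(53) p.286; Balaban1985Averaging, Proposition 7 p.43; Balaban1987RG1, (0.8) p.253] -/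
theorem norm_iterMh_expOver_mul_star_sub_one_le_level (hU₀ : SmallBelow (avOfRecord F N K) k U₀)
    (εs : ℕ → ℝ) (hε0 : ∀ j, 0 ≤ εs j)
    (hε : ∀ j, j < k → ∀ (c : PBond (F.P K) (j + 1)) (i : Idx (F.P K)), ‖loopM (coeField (Averaging.iter (avOfRecord F N K) j U₀)) c i - 1‖ ≤ εs j)
    (hε50 : ∀ j, j < k → εs j ≤ 1 / 50) (hNε : ∀ j, j < k → (N : ℝ) * εs j ≤ 2) (hεsum : 300000 * (Finset.range k).sum εs ≤ 1 / 4)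
    {Y : PBond (F.P K) 0 → Matrix (Fin N) (Fin N) ℂ} (hY : ∀ b, (Y b).trace = 0) (hsmall : (F.L : ℝ) ^ k * ‖Y‖ < 1 / (25000000000 * (F.L : ℝ) * N))
    {j : ℕ} (hjk : j ≤ k) (c : PBond (F.P K) j) :
    ‖iterMh j (expOver U₀ Y) c * star ((Averaging.iter (avOfRecord F N K) j U₀ c : SU N) : Matrix (Fin N) (Fin N) ℂ) - 1‖ ≤ 8000 * ((F.L : ℝ) ^ j * ‖Y‖) := by
  have hN1 : (1 : ℝ) ≤ N := by exact_mod_cast Nat.one_le_iff_ne_zero.2 (NeZero.ne N)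
  have hL12 : (12 : ℝ) ≤ F.L := by exact_mod_cast F.hL11
  have hd4 : ((F.P K).d : ℝ) = 4 := by rw [T4Family.P_d]; norm_num
  have hPL : ((F.P K).L : ℝ) = F.L := by rw [T4Family.P_L]
  have hY0 : 0 ≤ (F.L : ℝ) ^ k * ‖Y‖ := by positivity
  have hYj0 : 0 ≤ (F.L : ℝ) ^ j * ‖Y‖ := by positivity
  have hjk' : (F.L : ℝ) ^ j * ‖Y‖ ≤ (F.L : ℝ) ^ k * ‖Y‖ := mul_le_mul_of_nonneg_right (pow_le_pow_right₀ (by linarith) hjk) (norm_nonneg _)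
  have hsumj : (Finset.range j).sum εs ≤ (Finset.range k).sum εs :=
    Finset.sum_le_sum_of_subset_of_nonneg (Finset.range_mono hjk) fun i _ _ => hε0 i
  have hNρ : (N : ℝ) * ((F.L : ℝ) ^ k * ‖Y‖) ≤ 1 / 25000000000 := by
    have h1 : (N : ℝ) * ((F.L : ℝ) ^ k * ‖Y‖) ≤ N * (1 / (25000000000 * (F.L : ℝ) * N)) := mul_le_mul_of_nonneg_left hsmall.le (by positivity)
    have h2 : (N : ℝ) * (1 / (25000000000 * (F.L : ℝ) * N)) = 1 / (25000000000 * (F.L : ℝ)) := by field_simp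
    have h3 : 1 / (25000000000 * (F.L : ℝ)) ≤ 1 / 25000000000 := one_div_le_one_div_of_le (by norm_num) (by nlinarith)
    linarith
  have hLρ : (F.L : ℝ) * ((F.L : ℝ) ^ k * ‖Y‖) ≤ 1 / 25000000000 := by
    have h1 : (F.L : ℝ) * ((F.L : ℝ) ^ k * ‖Y‖) ≤ F.L * (1 / (25000000000 * (F.L : ℝ) * N)) := mul_le_mul_of_nonneg_left hsmall.le (by positivity)
    have h2 : (F.L : ℝ) * (1 / (25000000000 * (F.L : ℝ) * N)) = 1 / (25000000000 * (N : ℝ)) := by field_simp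
    have h3 : 1 / (25000000000 * (N : ℝ)) ≤ 1 / 25000000000 := one_div_le_one_div_of_le (by norm_num) (by nlinarith)
    linarith
  have hs : 12 * ((F.L : ℝ) ^ k * ‖Y‖) ≤ 1 / 25000000000 := (mul_le_mul_of_nonneg_right hL12 hY0).trans hLρ
  have hρ' : 8 * (((F.P K).d : ℝ) + 1) * (((F.P K).L : ℝ) ^ j * (2 * ‖Y‖)) ≤ 1 / 10 ^ 6 := by rw [hd4, hPL]; nlinarith
  have hQ' : 2 * (20000000 * (((F.P K).d : ℝ) + 1) ^ 2 * (F.P K).L) * (((F.P K).L : ℝ) ^ j * (2 * ‖Y‖)) + (60000 * (((F.P K).d : ℝ) + 1)) * (Finset.range j).sum εs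
      ≤ 1 / 2 := by
    rw [hd4, hPL]
    have : 2 * (20000000 * ((4 : ℝ) + 1) ^ 2 * F.L) * ((F.L : ℝ) ^ j * (2 * ‖Y‖)) = 2000000000 * ((F.L : ℝ) * ((F.L : ℝ) ^ j * ‖Y‖)) := by ring
    rw [this]
    have h4 : (F.L : ℝ) * ((F.L : ℝ) ^ j * ‖Y‖) ≤ 1 / 25000000000 := (mul_le_mul_of_nonneg_left hjk' (by linarith)).trans hLρ
    nlinarith [hsumj]
  have hN' : ∀ i, i < j → (N : ℝ) * (56 * (((F.P K).d : ℝ) + 1) * (((F.P K).L : ℝ) ^ j * (2 * ‖Y‖)) + εs i) ≤ 3 := by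
    intro i hi; rw [hd4, hPL]
    have h5 : (N : ℝ) * ((F.L : ℝ) ^ j * ‖Y‖) ≤ 1 / 25000000000 := (mul_le_mul_of_nonneg_left hjk' (by positivity)).trans hNρ
    nlinarith [hNε i (hi.trans_le hjk)]
  have h := norm_iterMh_expOver_mul_star_sub_one_le U₀ j (hU₀.mono hjk) εs hε0 (fun i hi => hε i (hi.trans_le hjk)) (fun i hi => hε50 i (hi.trans_le hjk)) hY hρ' hQ' hN' c
  rw [hd4, hPL] at h
  have h' : ‖iterMh j (expOver U₀ Y) c * star ((Averaging.iter (avOfRecord F N K) j U₀ c : SU N) : Matrix (Fin N) (Fin N) ℂ) - 1‖ ≤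
      1600 * (4 + 1) * ((F.L : ℝ) ^ j * ‖Y‖) := h
  linarith

/-- **THE HOLOMORPHIC ITERATES OF `e^{iY}U₀` ARE `SL(N, ℂ)`-VALUED** at every level `j ≤ k` (traceless `Y`; ✓`tower_induction`: `Ū^j_h = G•Ṽ` with `det G = det Ṽ = 1`).
[cite: Balaban1985Variational, p.307 («Gᶜ-valued fields»); Balaban1985Averaging, Proposition 7 p.43] -/
theorem det_iterMh_expOver_eq_one (hU₀ : SmallBelow (avOfRecord F N K) k U₀)
    (εs : ℕ → ℝ) (hε0 : ∀ j, 0 ≤ εs j)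
    (hε : ∀ j, j < k → ∀ (c : PBond (F.P K) (j + 1)) (i : Idx (F.P K)), ‖loopM (coeField (Averaging.iter (avOfRecord F N K) j U₀)) c i - 1‖ ≤ εs j)
    (hε50 : ∀ j, j < k → εs j ≤ 1 / 50) (hNε : ∀ j, j < k → (N : ℝ) * εs j ≤ 2) (hεsum : 300000 * (Finset.range k).sum εs ≤ 1 / 4)
    {Y : PBond (F.P K) 0 → Matrix (Fin N) (Fin N) ℂ} (hY : ∀ b, (Y b).trace = 0) (hsmall : (F.L : ℝ) ^ k * ‖Y‖ < 1 / (25000000000 * (F.L : ℝ) * N))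
    {j : ℕ} (hjk : j ≤ k) (b : PBond (F.P K) j) : (iterMh j (expOver U₀ Y) b).det = 1 := by
  have hN1 : (1 : ℝ) ≤ N := by exact_mod_cast Nat.one_le_iff_ne_zero.2 (NeZero.ne N)
  have hL12 : (12 : ℝ) ≤ F.L := by exact_mod_cast F.hL11
  have hd4 : ((F.P K).d : ℝ) = 4 := by rw [T4Family.P_d]; norm_num
  have hPL : ((F.P K).L : ℝ) = F.L := by rw [T4Family.P_L]
  have hY0 : 0 ≤ (F.L : ℝ) ^ k * ‖Y‖ := by positivity
  have hNρ : (N : ℝ) * ((F.L : ℝ) ^ k * ‖Y‖) ≤ 1 / 25000000000 := by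
    have h1 : (N : ℝ) * ((F.L : ℝ) ^ k * ‖Y‖) ≤ N * (1 / (25000000000 * (F.L : ℝ) * N)) := mul_le_mul_of_nonneg_left hsmall.le (by positivity)
    have h2 : (N : ℝ) * (1 / (25000000000 * (F.L : ℝ) * N)) = 1 / (25000000000 * (F.L : ℝ)) := by field_simp
    have h3 : 1 / (25000000000 * (F.L : ℝ)) ≤ 1 / 25000000000 := one_div_le_one_div_of_le (by norm_num) (by nlinarith)
    linarith
  have hLρ : (F.L : ℝ) * ((F.L : ℝ) ^ k * ‖Y‖) ≤ 1 / 25000000000 := by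
    have h1 : (F.L : ℝ) * ((F.L : ℝ) ^ k * ‖Y‖) ≤ F.L * (1 / (25000000000 * (F.L : ℝ) * N)) := mul_le_mul_of_nonneg_left hsmall.le (by positivity)
    have h2 : (F.L : ℝ) * (1 / (25000000000 * (F.L : ℝ) * N)) = 1 / (25000000000 * (N : ℝ)) := by field_simp
    have h3 : 1 / (25000000000 * (N : ℝ)) ≤ 1 / 25000000000 := one_div_le_one_div_of_le (by norm_num) (by nlinarith)
    linarith
  have hs : 12 * ((F.L : ℝ) ^ k * ‖Y‖) ≤ 1 / 25000000000 := (mul_le_mul_of_nonneg_right hL12 hY0).trans hLρ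
  have hρ' : 8 * (((F.P K).d : ℝ) + 1) * (((F.P K).L : ℝ) ^ k * (2 * ‖Y‖)) ≤ 1 / 10 ^ 6 := by rw [hd4, hPL]; linarith
  have hQ' : 2 * (20000000 * (((F.P K).d : ℝ) + 1) ^ 2 * (F.P K).L) * (((F.P K).L : ℝ) ^ k * (2 * ‖Y‖)) + (60000 * (((F.P K).d : ℝ) + 1)) * (Finset.range k).sum εs
      ≤ 1 / 2 := by rw [hd4, hPL]; linarith
  have hN' : ∀ i, i < k → (N : ℝ) * (56 * (((F.P K).d : ℝ) + 1) * (((F.P K).L : ℝ) ^ k * (2 * ‖Y‖)) + εs i) ≤ 3 := by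
    intro i hi; rw [hd4, hPL]; linarith [hNε i hi]
  obtain ⟨G, Vt, hGdet, -, hVdet, -, hiter⟩ := tower_induction U₀ k hU₀ εs hε0 hε hε50 hY hρ' hQ' hN' j hjk
  rw [hiter, Matrix.det_mul, Matrix.det_mul, hGdet, hVdet, det_inv_eq_one_of_det_eq_one (hGdet _), one_mul, one_mul]

/-- ★ **THE CONTOUR DRESSING AT LEVEL `j ≤ k`**: `‖Ū^j_h(e^{iY}U₀)(Γ_{y,x})·Ū^j(U₀)(Γ_{y,x})⋆ − 1‖ ≤ 32000·L^{j+1}‖Y‖·(1 + 32000·L^{j+1}‖Y‖)` (a centre contour has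
`≤ 4⌊(L−1)∕2⌋ ≤ 2L` steps, each dressing factor within `2·8000·L^j‖Y‖` of `1`; `(1+a)^n − 1 ≤ na + (na)²`). [cite: Balaban1985Averaging, (47) p.25, (58) p.27, (111) p.34; Balaban1987RG1, (0.3) p.252] -/
theorem norm_ctrHolM_iterMh_expOver_sub_one_le (hU₀ : SmallBelow (avOfRecord F N K) k U₀)
    (εs : ℕ → ℝ) (hε0 : ∀ j, 0 ≤ εs j)
    (hε : ∀ j, j < k → ∀ (c : PBond (F.P K) (j + 1)) (i : Idx (F.P K)), ‖loopM (coeField (Averaging.iter (avOfRecord F N K) j U₀)) c i - 1‖ ≤ εs j)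
    (hε50 : ∀ j, j < k → εs j ≤ 1 / 50) (hNε : ∀ j, j < k → (N : ℝ) * εs j ≤ 2) (hεsum : 300000 * (Finset.range k).sum εs ≤ 1 / 4)
    {Y : PBond (F.P K) 0 → Matrix (Fin N) (Fin N) ℂ} (hY : ∀ b, (Y b).trace = 0) (hsmall : (F.L : ℝ) ^ k * ‖Y‖ < 1 / (25000000000 * (F.L : ℝ) * N))
    {j : ℕ} (hjk : j ≤ k) (y : Site (F.P K) (j + 1)) (r : Fin (F.P K).d → Fin (F.P K).L) :
    ‖ctrHolM (iterMh j (expOver U₀ Y)) y r * star ((ctrHol (Averaging.iter (avOfRecord F N K) j U₀) y r : SU N) : Matrix (Fin N) (Fin N) ℂ) - 1‖ ≤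
      32000 * ((F.L : ℝ) ^ (j + 1) * ‖Y‖) * (1 + 32000 * ((F.L : ℝ) ^ (j + 1) * ‖Y‖)) := by
  have hN1 : (1 : ℝ) ≤ N := by exact_mod_cast Nat.one_le_iff_ne_zero.2 (NeZero.ne N)
  have hL12 : (12 : ℝ) ≤ F.L := by exact_mod_cast F.hL11
  have hPL : ((F.P K).L : ℝ) = F.L := by rw [T4Family.P_L]
  have hx0 : 0 ≤ (F.L : ℝ) ^ j * ‖Y‖ := by positivity
  -- the per-bond bound at level j and its smallness
  have hδ := norm_iterMh_expOver_mul_star_sub_one_le_level F N k U₀ hU₀ εs hε0 hε hε50 hNε hεsum hY hsmall hjk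
  have hjk' : (F.L : ℝ) ^ j * ‖Y‖ ≤ (F.L : ℝ) ^ k * ‖Y‖ := mul_le_mul_of_nonneg_right (pow_le_pow_right₀ (by linarith) hjk) (norm_nonneg _)
  have hρk : (F.L : ℝ) ^ k * ‖Y‖ ≤ 1 / 25000000000 := by
    refine hsmall.le.trans (one_div_le_one_div_of_le (by norm_num) ?_)
    nlinarith [mul_le_mul hL12 hN1 (by norm_num) (by linarith : (0:ℝ) ≤ F.L)]
  have hδ2 : 8000 * ((F.L : ℝ) ^ j * ‖Y‖) ≤ 1 / 2 := by linarith
  have h := norm_ctrHolM_mul_star_sub_one_le (Averaging.iter (avOfRecord F N K) j U₀)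
    (fun b => det_iterMh_expOver_eq_one F N k U₀ hU₀ εs hε0 hε hε50 hNε hεsum hY hsmall hjk b) hδ hδ2 y r
  refine h.trans ?_
  -- `(1 + 2δ)^n − 1 ≤ na + (na)²` with `n = 4⌊(L−1)∕2⌋ ≤ 2L`, `a = 16000·L^j‖Y‖`
  have hn : (F.P K).d * (((F.P K).L - 1) / 2) ≤ 2 * F.L := by rw [T4Family.P_d, T4Family.P_L]; omega
  have hn' : (((F.P K).d * (((F.P K).L - 1) / 2) : ℕ) : ℝ) ≤ 2 * (F.L : ℝ) := by exact_mod_cast hn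
  set n : ℕ := (F.P K).d * (((F.P K).L - 1) / 2) with hndef
  set a : ℝ := 2 * (8000 * ((F.L : ℝ) ^ j * ‖Y‖)) with hadef
  have ha0 : 0 ≤ a := by positivity
  have hLx : (F.L : ℝ) ^ (j + 1) * ‖Y‖ = F.L * ((F.L : ℝ) ^ j * ‖Y‖) := by ring
  have hna : (n : ℝ) * a ≤ 32000 * ((F.L : ℝ) ^ (j + 1) * ‖Y‖) := by
    rw [hLx, hadef]; nlinarith
  have hu : 32000 * ((F.L : ℝ) ^ (j + 1) * ‖Y‖) ≤ 1 := by
    rw [hLx]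
    have : (F.L : ℝ) * ((F.L : ℝ) ^ j * ‖Y‖) ≤ F.L * ((F.L : ℝ) ^ k * ‖Y‖) := mul_le_mul_of_nonneg_left hjk' (by linarith)
    have h2 : (F.L : ℝ) * ((F.L : ℝ) ^ k * ‖Y‖) ≤ F.L * (1 / (25000000000 * (F.L : ℝ) * N)) := mul_le_mul_of_nonneg_left hsmall.le (by positivity)
    have h3 : (F.L : ℝ) * (1 / (25000000000 * (F.L : ℝ) * N)) = 1 / (25000000000 * (N : ℝ)) := by field_simp
    have h4 : 1 / (25000000000 * (N : ℝ)) ≤ 1 / 25000000000 := one_div_le_one_div_of_le (by norm_num) (by nlinarith)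
    linarith
  have hna1 : (n : ℝ) * a ≤ 1 := hna.trans hu
  have hp := pow_sub_one_sub_le_sq ha0 n hna1
  have hmono : (n : ℝ) * a + ((n : ℝ) * a) ^ 2 ≤ 32000 * ((F.L : ℝ) ^ (j + 1) * ‖Y‖) + (32000 * ((F.L : ℝ) ^ (j + 1) * ‖Y‖)) ^ 2 := by
    have hna0 : 0 ≤ (n : ℝ) * a := by positivity
    nlinarith [pow_le_pow_left₀ hna0 hna 2]
  nlinarith [hp, hmono]

/-! ## §2  The budget `B_j = 40000·L^j‖Y‖` absorbs one step (L ≥ 12), hence dominates every level -/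

/-- **ONE-STEP ABSORPTION** (real arithmetic): with `x = L^j‖Y‖`, `u = L·x ≤ 4·10⁻¹¹`, `L ≥ 12`, `τ ≤ 32000u(1 + 32000u)`:
`40000x + τ + 20(40000x + τ)² ≤ 40000u` and `40000x + τ ≤ 1∕50`. [folklore] -/
theorem budget_step {L x τ : ℝ} (hL : 12 ≤ L) (hx : 0 ≤ x) (hu : L * x ≤ 1 / 25000000000) (hτ0 : 0 ≤ τ) (hτ : τ ≤ 32000 * (L * x) * (1 + 32000 * (L * x))) :
    40000 * x + τ + 20 * (40000 * x + τ) ^ 2 ≤ 40000 * (L * x) ∧ 40000 * x + τ ≤ 1 / 50 := by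
  have hu0 : 0 ≤ L * x := by positivity
  have hxu : 12 * x ≤ L * x := mul_le_mul_of_nonneg_right hL hx
  have hτ' : τ ≤ 32001 * (L * x) := by nlinarith
  have hsum : 40000 * x + τ ≤ 35335 * (L * x) := by nlinarith
  have hsq : (40000 * x + τ) ^ 2 ≤ (35335 * (L * x)) ^ 2 := pow_le_pow_left₀ (by positivity) hsum 2
  have hsq' : (35335 * (L * x)) ^ 2 ≤ 1 / 20 * (L * x) := by nlinarith
  constructor
  · nlinarith
  · nlinarith

/-- ★★★ **(T2) AT THE RECORD, EVERY LEVEL, k-UNIFORMLY**: on the traceless scaled polydisc `L^k‖Y‖ < ρ₀ = (2.5·10¹⁰·L·N)⁻¹`, under the loop profile of the real tower (F5ᵖʳ's rows),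
`‖Φ_j(e^{iY}U₀)(x) − 1‖ ≤ 40000·L^j‖Y‖` and `‖Ψ_j(e^{iY}U₀)(x) − 1‖ ≤ 40000·L^j‖Y‖` for all `j ≤ k` and all `x` — print's (89) `|R^{(j)}(V) − 1| ≤ O(1)·(scaled size of V − U₀)`
with an explicit `O(1)` independent of `j`, `k`, `L`, `N`. [cite: Balaban1985Averaging, (89) p.31, (81) p.30, (84)–(87) pp.30–31, (101)–(106) p.33] -/
theorem norm_framePair_expOver_sub_one_le (hU₀ : SmallBelow (avOfRecord F N K) k U₀)
    (εs : ℕ → ℝ) (hε0 : ∀ j, 0 ≤ εs j)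
    (hε : ∀ j, j < k → ∀ (c : PBond (F.P K) (j + 1)) (i : Idx (F.P K)), ‖loopM (coeField (Averaging.iter (avOfRecord F N K) j U₀)) c i - 1‖ ≤ εs j)
    (hε50 : ∀ j, j < k → εs j ≤ 1 / 50) (hNε : ∀ j, j < k → (N : ℝ) * εs j ≤ 2) (hεsum : 300000 * (Finset.range k).sum εs ≤ 1 / 4)
    {Y : PBond (F.P K) 0 → Matrix (Fin N) (Fin N) ℂ} (hY : ∀ b, (Y b).trace = 0) (hsmall : (F.L : ℝ) ^ k * ‖Y‖ < 1 / (25000000000 * (F.L : ℝ) * N)) :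
    ∀ j, j ≤ k → ∀ x : Site (F.P K) j,
      ‖(framePair (avOfRecord F N K) U₀ (expOver U₀ Y) j x).1 - 1‖ ≤ 40000 * ((F.L : ℝ) ^ j * ‖Y‖) ∧
        ‖(framePair (avOfRecord F N K) U₀ (expOver U₀ Y) j x).2 - 1‖ ≤ 40000 * ((F.L : ℝ) ^ j * ‖Y‖) := by
  have hN1 : (1 : ℝ) ≤ N := by exact_mod_cast Nat.one_le_iff_ne_zero.2 (NeZero.ne N)
  have hL12 : (12 : ℝ) ≤ F.L := by exact_mod_cast F.hL11
  refine norm_framePair_sub_one_le_of_budget (avOfRecord F N K) U₀ (expOver U₀ Y) k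
    (fun j => 32000 * ((F.L : ℝ) ^ (j + 1) * ‖Y‖) * (1 + 32000 * ((F.L : ℝ) ^ (j + 1) * ‖Y‖))) (fun j => 40000 * ((F.L : ℝ) ^ j * ‖Y‖))
    (fun j hj y r => norm_ctrHolM_iterMh_expOver_sub_one_le F N k U₀ hU₀ εs hε0 hε hε50 hNε hεsum hY hsmall hj.le y r) (by positivity) ?_ ?_
  · intro j hj
    have hx : 0 ≤ (F.L : ℝ) ^ j * ‖Y‖ := by positivity
    have hLx : (F.L : ℝ) ^ (j + 1) * ‖Y‖ = F.L * ((F.L : ℝ) ^ j * ‖Y‖) := by ring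
    have hu : (F.L : ℝ) * ((F.L : ℝ) ^ j * ‖Y‖) ≤ 1 / 25000000000 := by
      have hjk' : (F.L : ℝ) ^ (j + 1) * ‖Y‖ ≤ (F.L : ℝ) ^ k * ‖Y‖ := mul_le_mul_of_nonneg_right (pow_le_pow_right₀ (by linarith) hj) (norm_nonneg _)
      rw [← hLx]
      refine hjk'.trans (hsmall.le.trans (one_div_le_one_div_of_le (by norm_num) ?_))
      nlinarith [mul_le_mul hL12 hN1 (by norm_num) (by linarith : (0:ℝ) ≤ F.L)]
    rw [hLx]
    exact (budget_step hL12 hx hu (by positivity) le_rfl).1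
  · intro j hj
    have hx : 0 ≤ (F.L : ℝ) ^ j * ‖Y‖ := by positivity
    have hLx : (F.L : ℝ) ^ (j + 1) * ‖Y‖ = F.L * ((F.L : ℝ) ^ j * ‖Y‖) := by ring
    have hu : (F.L : ℝ) * ((F.L : ℝ) ^ j * ‖Y‖) ≤ 1 / 25000000000 := by
      have hjk' : (F.L : ℝ) ^ (j + 1) * ‖Y‖ ≤ (F.L : ℝ) ^ k * ‖Y‖ := mul_le_mul_of_nonneg_right (pow_le_pow_right₀ (by linarith) hj) (norm_nonneg _)
      rw [← hLx]
      refine hjk'.trans (hsmall.le.trans (one_div_le_one_div_of_le (by norm_num) ?_))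
      nlinarith [mul_le_mul hL12 hN1 (by norm_num) (by linarith : (0:ℝ) ≤ F.L)]
    rw [hLx]
    exact (budget_step hL12 hx hu (by positivity) le_rfl).2

/-! ## §3  (T1) the window, and the door binders (hdom)∕(hnear) for `hierFrameDatumOfRecord` with `c𝔥 = 40000` -/

/-- ★★★ **(T1) AT THE RECORD: `e^{iY}U₀` LIES IN THE WINDOW `hierFrameDom`** — every holomorphic loop of every iterate `< k` within `½` of `1` (✓`polydiscPackage_of_loopProfile`) and every
argument of the logarithms of (85) within `2B_j + τ_j + (2B_j+τ_j)² ≤ 1∕25 + 1∕625` of `1`. [cite: Balaban1985Averaging, (81) p.30, (85) p.30; Balaban1987RG1, (0.4) p.253] -/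
theorem expOver_mem_hierFrameDom (hU₀ : SmallBelow (avOfRecord F N K) k U₀)
    (εs : ℕ → ℝ) (hε0 : ∀ j, 0 ≤ εs j)
    (hε : ∀ j, j < k → ∀ (c : PBond (F.P K) (j + 1)) (i : Idx (F.P K)), ‖loopM (coeField (Averaging.iter (avOfRecord F N K) j U₀)) c i - 1‖ ≤ εs j)
    (hε50 : ∀ j, j < k → εs j ≤ 1 / 50) (hNε : ∀ j, j < k → (N : ℝ) * εs j ≤ 2) (hεsum : 300000 * (Finset.range k).sum εs ≤ 1 / 4)
    {Y : PBond (F.P K) 0 → Matrix (Fin N) (Fin N) ℂ} (hY : ∀ b, (Y b).trace = 0) (hsmall : (F.L : ℝ) ^ k * ‖Y‖ < 1 / (25000000000 * (F.L : ℝ) * N)) :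
    expOver U₀ Y ∈ hierFrameDom (avOfRecord F N K) U₀ k := by
  have hN1 : (1 : ℝ) ≤ N := by exact_mod_cast Nat.one_le_iff_ne_zero.2 (NeZero.ne N)
  have hL12 : (12 : ℝ) ≤ F.L := by exact_mod_cast F.hL11
  obtain ⟨hloops, -⟩ := polydiscPackage_of_loopProfile F N k U₀ hU₀ εs hε0 hε hε50 hNε hεsum hY hsmall
  intro j hj
  refine ⟨fun c i => (hloops j hj c i).trans_lt (by norm_num), fun y r => ?_⟩
  -- the budget rows (as in `norm_framePair_expOver_sub_one_le`)
  have hstep : ∀ j, j < k → 40000 * ((F.L : ℝ) ^ j * ‖Y‖) + 32000 * ((F.L : ℝ) ^ (j + 1) * ‖Y‖) * (1 + 32000 * ((F.L : ℝ) ^ (j + 1) * ‖Y‖)) +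
      20 * (40000 * ((F.L : ℝ) ^ j * ‖Y‖) + 32000 * ((F.L : ℝ) ^ (j + 1) * ‖Y‖) * (1 + 32000 * ((F.L : ℝ) ^ (j + 1) * ‖Y‖))) ^ 2 ≤
        40000 * ((F.L : ℝ) ^ (j + 1) * ‖Y‖) ∧
      40000 * ((F.L : ℝ) ^ j * ‖Y‖) + 32000 * ((F.L : ℝ) ^ (j + 1) * ‖Y‖) * (1 + 32000 * ((F.L : ℝ) ^ (j + 1) * ‖Y‖)) ≤ 1 / 50 := by
    intro j hj
    have hx : 0 ≤ (F.L : ℝ) ^ j * ‖Y‖ := by positivity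
    have hLx : (F.L : ℝ) ^ (j + 1) * ‖Y‖ = F.L * ((F.L : ℝ) ^ j * ‖Y‖) := by ring
    have hu : (F.L : ℝ) * ((F.L : ℝ) ^ j * ‖Y‖) ≤ 1 / 25000000000 := by
      have hjk' : (F.L : ℝ) ^ (j + 1) * ‖Y‖ ≤ (F.L : ℝ) ^ k * ‖Y‖ := mul_le_mul_of_nonneg_right (pow_le_pow_right₀ (by linarith) hj) (norm_nonneg _)
      rw [← hLx]
      refine hjk'.trans (hsmall.le.trans (one_div_le_one_div_of_le (by norm_num) ?_))
      nlinarith [mul_le_mul hL12 hN1 (by norm_num) (by linarith : (0:ℝ) ≤ F.L)]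
    rw [hLx]
    exact budget_step hL12 hx hu (by positivity) le_rfl
  have h := norm_frameArg_framePair_sub_one_le_of_budget (avOfRecord F N K) U₀ (expOver U₀ Y) k
    (fun j => 32000 * ((F.L : ℝ) ^ (j + 1) * ‖Y‖) * (1 + 32000 * ((F.L : ℝ) ^ (j + 1) * ‖Y‖))) (fun j => 40000 * ((F.L : ℝ) ^ j * ‖Y‖))
    (fun j hj y r => norm_ctrHolM_iterMh_expOver_sub_one_le F N k U₀ hU₀ εs hε0 hε hε50 hNε hεsum hY hsmall hj.le y r) (by positivity)
    (fun j hj => (hstep j hj).1) (fun j hj => (hstep j hj).2) hj y r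
  refine h.trans_lt ?_
  have hs := (hstep j hj).2
  have h0 : 0 ≤ 40000 * ((F.L : ℝ) ^ j * ‖Y‖) := by positivity
  have h1 : 0 ≤ 32000 * ((F.L : ℝ) ^ (j + 1) * ‖Y‖) * (1 + 32000 * ((F.L : ℝ) ^ (j + 1) * ‖Y‖)) := by positivity
  nlinarith

/-- ★★★ **(hdom) FOR THE RECORD's INHABITANT, AS A THEOREM** — the binder PT-B's framed doors display, at `𝔥 := hierFrameDatumOfRecord F N k U₀`, discharged from the loop profile of the
real tower: every traceless `Y` on the scaled polydisc has `e^{iY}U₀ ∈ 𝔥.dom` (on the guard `𝔥.dom = hierFrameDom`). [cite: Balaban1985Averaging, (81) p.30, (85) p.30] -/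
theorem hierFrameDatumOfRecord_hdom (hU₀ : SmallBelow (avOfRecord F N K) k U₀)
    (εs : ℕ → ℝ) (hε0 : ∀ j, 0 ≤ εs j)
    (hε : ∀ j, j < k → ∀ (c : PBond (F.P K) (j + 1)) (i : Idx (F.P K)), ‖loopM (coeField (Averaging.iter (avOfRecord F N K) j U₀)) c i - 1‖ ≤ εs j)
    (hε50 : ∀ j, j < k → εs j ≤ 1 / 50) (hNε : ∀ j, j < k → (N : ℝ) * εs j ≤ 2) (hεsum : 300000 * (Finset.range k).sum εs ≤ 1 / 4) :
    ∀ Y : PBond (F.P K) 0 → Matrix (Fin N) (Fin N) ℂ, (∀ b, (Y b).trace = 0) → (F.L : ℝ) ^ k * ‖Y‖ < 1 / (25000000000 * (F.L : ℝ) * N) →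
      expOver U₀ Y ∈ (hierFrameDatumOfRecord F N k U₀).dom := by
  intro Y hY hsmall
  rw [hierFrameDatumOfRecord_dom F N k U₀ hU₀]
  exact expOver_mem_hierFrameDom F N k U₀ hU₀ εs hε0 hε hε50 hNε hεsum hY hsmall

/-- ★★★ **(hnear) FOR THE RECORD's INHABITANT, AS A THEOREM, `c𝔥 = 40000`** — `‖𝔥.map(e^{iY}U₀)(y) − 1‖, ‖𝔥.inv(e^{iY}U₀)(y) − 1‖ ≤ 40000·L^k‖Y‖` for traceless `Y` on the scaled
polydisc (`𝔥.map = Ψ_k`, `𝔥.inv = Φ_k` on the guard). [cite: Balaban1985Averaging, (89) p.31, (84)–(87) pp.30–31] -/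
theorem hierFrameDatumOfRecord_hnear (hU₀ : SmallBelow (avOfRecord F N K) k U₀)
    (εs : ℕ → ℝ) (hε0 : ∀ j, 0 ≤ εs j)
    (hε : ∀ j, j < k → ∀ (c : PBond (F.P K) (j + 1)) (i : Idx (F.P K)), ‖loopM (coeField (Averaging.iter (avOfRecord F N K) j U₀)) c i - 1‖ ≤ εs j)
    (hε50 : ∀ j, j < k → εs j ≤ 1 / 50) (hNε : ∀ j, j < k → (N : ℝ) * εs j ≤ 2) (hεsum : 300000 * (Finset.range k).sum εs ≤ 1 / 4) :
    ∀ Y : PBond (F.P K) 0 → Matrix (Fin N) (Fin N) ℂ, (∀ b, (Y b).trace = 0) → (F.L : ℝ) ^ k * ‖Y‖ < 1 / (25000000000 * (F.L : ℝ) * N) →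
      ∀ y : Site (F.P K) k, ‖(hierFrameDatumOfRecord F N k U₀).map (expOver U₀ Y) y - 1‖ ≤ 40000 * ((F.L : ℝ) ^ k * ‖Y‖) ∧
        ‖(hierFrameDatumOfRecord F N k U₀).inv (expOver U₀ Y) y - 1‖ ≤ 40000 * ((F.L : ℝ) ^ k * ‖Y‖) := by
  intro Y hY hsmall y
  have h := norm_framePair_expOver_sub_one_le F N k U₀ hU₀ εs hε0 hε hε50 hNε hεsum hY hsmall k le_rfl y
  rw [hierFrameDatumOfRecord_map F N k U₀ hU₀, hierFrameDatumOfRecord_inv F N k U₀ hU₀]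
  exact ⟨h.2, h.1⟩

end Record

end Summit.QuantumFields.YangMills.Theorems.C44IterMh

end
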